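import Mathlib

/-!
# T5DyadicOrbit — the group-theoretic core of T5-SUPPORT-p3 §9(iv) / §11 (blind cell pub-hodge-repro2, seat p3)

Setting (prose, not formalised): `F` the Galois CM sextic, `G = Gal(F/ℚ) ≅ ℤ/6`, written additively
as `ZMod 6`; `3 ∈ ZMod 6` is complex conjugation (the generator of `Gal(F/F⁺)`), `2` generates
`Gal(F/K)` with `K ⊂ F` the imaginary quadratic subfield.  `D ≤ G` is the decomposition group of a
prime of `F` above `2` — one subgroup for all of them, `G` being abelian (Marcus, Number Fields,
Thm 23: the primes above `2` form one `G`-orbit; `D(σQ|P) = σ D(Q|P) σ⁻¹`).  Printed dictionary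
(Marcus, Thm 28 (proof: the primes above `P` ↔ the cosets of `D`), p. «D(Q|P′) = D ∩ H», Thm 29 and
its Corollary for abelian `G`):

* the number of primes of `F⁺ = F^{⟨3⟩}` above `2` is `[G : D ⊔ ⟨3⟩]`;
* a prime `w` of `F⁺` above `2` is NON-SPLIT in `F` ⟺ `D ∩ ⟨3⟩ = ⟨3⟩` ⟺ `3 ∈ D`;
* `2` is NON-SPLIT in `K = F^{⟨2⟩}` ⟺ `D ⊔ ⟨2⟩ = G` ⟺ `¬ D ≤ ⟨2⟩`.

What is kernel-checked here is the pure group theory behind §9(iv):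
`three_mem_iff_not_le_two` (`3 ∈ D ↔ ¬ D ≤ ⟨2⟩`: «all dyadic places of `F⁺` are non-split in `F`
⟺ `2` is non-split in `K`»), `index_sup_three_eq_one_or_three` (`[G : D ⊔ ⟨3⟩] ∈ {1, 3}`: the number
of dyadic places of the cubic field is `1` or `3`), `index_eq_of_three_mem` (`3 ∈ D → D ⊔ ⟨3⟩ = D`),
and the abstract orbit lemma `invariant_set_eq_empty_or_univ` (a `G`-invariant subset of a
transitive `G`-set is empty or everything: the set of «bad» dyadic places is `∅` or all of them).
Nothing about number fields is asserted in Lean; the dictionary above is the prose [C] of §11.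
-/

namespace Summit.Ventures.HodgeRepro2.T5DyadicOrbit

open AddSubgroup

/-- A `G`-invariant subset of a transitive `G`-set is empty or everything. -/
theorem invariant_set_eq_empty_or_univ {G P : Type*} [Group G] [MulAction G P]
    [MulAction.IsPretransitive G P] (S : Set P) (hS : ∀ (g : G) (p : P), p ∈ S → g • p ∈ S) :
    S = ∅ ∨ S = Set.univ := by
  by_cases h : S = ∅
  · exact Or.inl h
  · right
    obtain ⟨p, hp⟩ := Set.nonempty_iff_ne_empty.mpr h
    ext q
    refine ⟨fun _ => trivial, fun _ => ?_⟩
    obtain ⟨g, rfl⟩ := MulAction.exists_smul_eq G p q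
    exact hS g p hp

/-- Membership in `⟨2⟩ ⊂ ℤ/6`. -/
theorem mem_zmultiples_two_iff (x : ZMod 6) :
    x ∈ zmultiples (2 : ZMod 6) ↔ x = 0 ∨ x = 2 ∨ x = 4 := by
  rw [mem_zmultiples_iff]
  constructor
  · rintro ⟨k, rfl⟩
    rw [zsmul_eq_mul]
    generalize (k : ZMod 6) = c
    revert c
    decide
  · rintro (rfl | rfl | rfl)
    · exact ⟨0, by simp⟩
    · exact ⟨1, by simp⟩
    · exact ⟨2, by decide⟩

/-- Membership in `⟨3⟩ ⊂ ℤ/6`. -/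
theorem mem_zmultiples_three_iff (x : ZMod 6) :
    x ∈ zmultiples (3 : ZMod 6) ↔ x = 0 ∨ x = 3 := by
  rw [mem_zmultiples_iff]
  constructor
  · rintro ⟨k, rfl⟩
    rw [zsmul_eq_mul]
    generalize (k : ZMod 6) = c
    revert c
    decide
  · rintro (rfl | rfl)
    · exact ⟨0, by simp⟩
    · exact ⟨1, by simp⟩

/-- `3 ∈ D ↔ ¬ D ≤ ⟨2⟩`: in ℤ/6, a subgroup contains the element of order two iff it is not
contained in the index-two subgroup.  Dictionary: «every dyadic place of `F⁺` is non-split in `F`»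
⟺ «`2` is non-split in `K`». -/
theorem three_mem_iff_not_le_two (D : AddSubgroup (ZMod 6)) :
    (3 : ZMod 6) ∈ D ↔ ¬ D ≤ zmultiples (2 : ZMod 6) := by
  constructor
  · intro h3 hle
    have := (mem_zmultiples_two_iff 3).mp (hle h3)
    revert this
    decide
  · intro hnle
    obtain ⟨x, hxD, hx2⟩ := SetLike.not_le_iff_exists.mp hnle
    have key : ∀ y : ZMod 6, ¬ (y = 0 ∨ y = 2 ∨ y = 4) → y = 1 ∨ y = 3 ∨ y = 5 := by
      decide
    have hx : x = 1 ∨ x = 3 ∨ x = 5 := key x ((mem_zmultiples_two_iff x).not.mp hx2)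
    have h3x : (3 : ℕ) • x = 3 := by
      rcases hx with rfl | rfl | rfl <;> decide
    rw [← h3x]
    exact D.nsmul_mem hxD 3

/-- `addOrderOf (3 : ZMod 6) = 2`. -/
theorem addOrderOf_three : addOrderOf (3 : ZMod 6) = 2 :=
  addOrderOf_eq_prime (by decide) (by decide)

/-- `[ℤ/6 : ⟨3⟩] = 3`. -/
theorem index_zmultiples_three : (zmultiples (3 : ZMod 6)).index = 3 := by
  have h := (zmultiples (3 : ZMod 6)).card_mul_index
  rw [Nat.card_zmultiples, addOrderOf_three, Nat.card_eq_fintype_card, ZMod.card] at h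
  omega

/-- `[G : D ⊔ ⟨3⟩] ∈ {1, 3}`: the number of dyadic places of the cubic field `F⁺` is `1` or `3`. -/
theorem index_sup_three_eq_one_or_three (D : AddSubgroup (ZMod 6)) :
    (D ⊔ zmultiples (3 : ZMod 6)).index = 1 ∨ (D ⊔ zmultiples (3 : ZMod 6)).index = 3 := by
  have hdvd : (D ⊔ zmultiples (3 : ZMod 6)).index ∣ (zmultiples (3 : ZMod 6)).index :=
    index_dvd_of_le le_sup_right
  rw [index_zmultiples_three] at hdvd
  exact (Nat.dvd_prime Nat.prime_three).mp hdvd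

/-- If `3 ∈ D` (all dyadic places of `F⁺` non-split in `F`) then `D ⊔ ⟨3⟩ = D`: the number of
dyadic places of `F⁺` is `[G : D]`, the number of primes of `F` above `2`. -/
theorem sup_three_eq_of_three_mem (D : AddSubgroup (ZMod 6)) (h : (3 : ZMod 6) ∈ D) :
    D ⊔ zmultiples (3 : ZMod 6) = D :=
  sup_eq_left.mpr ((zmultiples_le).mpr h)

/-- The number of «bad-capable» dyadic places (non-split in `F`) is `0` when `3 ∉ D` and
`[G : D] ∈ {1, 3}` when `3 ∈ D` — the shape `|D| ∈ {0, 1, 3}` of §9(iv). -/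
theorem index_eq_one_or_three_of_three_mem (D : AddSubgroup (ZMod 6)) (h : (3 : ZMod 6) ∈ D) :
    D.index = 1 ∨ D.index = 3 := by
  have := index_sup_three_eq_one_or_three D
  rwa [sup_three_eq_of_three_mem D h] at this

end Summit.Ventures.HodgeRepro2.T5DyadicOrbit
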